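import Summits.ResolutionOfSingularities.ResolutionOfSingularities.Theorems.FrobeniusClosingPatchingRelPerfectDepthSNCCoincidenceLift
import Summits.ResolutionOfSingularities.ResolutionOfSingularities.Theorems.FrobeniusClosingPatchingRelPerfectDepthEndTwoMonomialGlue
import Summits.ResolutionOfSingularities.ResolutionOfSingularities.Theorems.FrobeniusClosingPatchingRelPerfectDepthBoundaryLiftPointwise
import Summits.ResolutionOfSingularities.ResolutionOfSingularities.Theorems.FrobeniusClosingPatchingRelPerfectDepthSepFormat
import HarnessLib

/-!
# Crux `PatchingRelPerfect` (stmt-ResolutionOfSingularities-16161), chain W5.2 — F6 stage 2 («separation of two regular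
# hypersurfaces»): the two-monomial END, assembled from format-level data

[OURS · L1 W5.2 · rung tool] Replaces the role of NO printed item; NOT a statement of the manuscript under review; fact-free.
res-L1-w52-plan-1's TargetsF6 part S (`EndTwoMonomialSep Q`, conclusion literally that of `EndTwoMonomialJR`) for res-D-pv-016's
stage-2 format `Q = DepthGraded.SepFormat` (p520204): `K = 𝓗 ⊔ monomialIdeal 𝒩 · 𝓘_E²`, global `HasSNC (𝓘_E :: boundaryOf 𝒩)`,
the POCKET field off `i(E)`, and the E-side END `EndSep (K|_E) 𝒟` read through the traces (`𝒟 = 𝒩|_E`): at every point of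
`V(K|_E)` the host trace has ORDER ONE, NO CHARGED member's trace coincides with it, and EITHER some (uncharged) member's trace
coincides with it OR `K|_E :: (charged traces)` is snc. This file proves the END from exactly these data, GENERIC in the names
(the by-name wrapper `EndTwoMonomialSep SepFormat` is a destructuring once part S is filed):

* ON `i(E)`, snc case — res-D-pv-052's `DepthRetract.sncWithAt_host_cons` (host trace not a charged member: by non-coincidence);
* ON `i(E)`, coincidence case — res-D-pv-009's `DepthSNC.sncWithAt_host_cons_of_coincidence_top` (the coinciding member is
  uncharged by non-coincidence, so every charged member is kept);
* OFF `i(E)` — the pocket field; assembly by `DepthSNC.exists_endTwoMonomial_of_halves` with EMPTY host-exponent list.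

* `comap_host_format_two` — `K|_E = 𝓗|_E` for `K = 𝓗 ⊔ M·𝓘_E²`;
* `filter_map_trace`, `boundaryOf_filter_map_trace` — charged traces = traces of charged members;
* **`exists_endTwoMonomial_sep`** — the END.

## References
* J. Kollár, *Lectures on Resolution of Singularities* (2007), (3.111) Step 3, Cor. 3.85. [Kollar2007]
* E. Bierstone, D. Grigoriev, P. Milman, J. Włodarczyk, arXiv:1206.3090, §4 Step 2b. [BierstoneGrigorievMilmanWlodarczyk2011]
-/

-- `Summit.<Summit>.<Sub>.Theorems` with `Sub = Summit` (single-conjunct summit, D-0017)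
set_option linter.dupNamespace false

noncomputable section

open CategoryTheory CategoryTheory.Limits AlgebraicGeometry TopologicalSpace IsLocalRing
open Literature.AlgebraicGeometry.Resolution
open Scheme.IdealSheafData

namespace Summit.ResolutionOfSingularities.ResolutionOfSingularities.Theorems

universe u

namespace DepthSNC

variable {E X : Scheme.{u}} (i : E ⟶ X) [IsClosedImmersion i]

omit [IsClosedImmersion i] in
/-- `K|_E = 𝓗|_E` for `K = 𝓗 ⊔ M · 𝓘_E^ℓ`, `ℓ ≥ 1`. [folklore] -/
theorem comap_host_format {K 𝓗 M : X.IdealSheafData} {ℓ : ℕ} (hℓ : ℓ ≠ 0) (hK : K = 𝓗 ⊔ M * i.ker ^ ℓ) :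
    K.comap i = 𝓗.comap i := by
  rw [hK, Scheme.IdealSheafData.comap_sup, comap_mul, comap_pow, comap_ker_self, bot_eq_zero, zero_pow hℓ, mul_zero,
    ← bot_eq_zero, sup_bot_eq]

omit [IsClosedImmersion i] in
/-- Filtering by the exponent commutes with taking traces. [folklore] -/
theorem filter_map_trace (𝒩 : List (X.IdealSheafData × ℕ)) :
    (𝒩.map fun p => (p.1.comap i, p.2)).filter (fun p => decide (0 < p.2)) =
      (𝒩.filter fun p => decide (0 < p.2)).map fun p => (p.1.comap i, p.2) := by
  rw [List.filter_map]; rfl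

omit [IsClosedImmersion i] in
/-- The charged traces are the traces of the charged members. [folklore] -/
theorem boundaryOf_filter_map_trace (𝒩 : List (X.IdealSheafData × ℕ)) :
    boundaryOf ((𝒩.map fun p => (p.1.comap i, p.2)).filter fun p => decide (0 < p.2)) =
      (boundaryOf (𝒩.filter fun p => decide (0 < p.2))).map fun G => G.comap i := by
  rw [filter_map_trace, boundaryOf, boundaryOf, List.map_map, List.map_map]; rfl

/-- [OURS · L1 W5.2] **The two-monomial END of F6 stage 2, from format-level data.** `i : E ⟶ X` a closed immersion with
`𝓘_E = ker i` effective Cartier; `𝓗` an effective Cartier host; `𝒩` a list of effective Cartier divisors with exponents;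
`K = 𝓗 ⊔ monomialIdeal 𝒩 · 𝓘_E²`; `HasSNC (𝓘_E :: boundaryOf 𝒩)`; the POCKET field off `i(E)`; and ON `E`, at every point of
`V(K|_E)`: order one of the trace, no coincidence with a charged member's trace, and coincidence-or-snc (the three clauses of
`EndSep`, traces written as `G|_E`). Then `K = ⊤ · (mono A ⊔ mono B)` with `A = endListA 𝓗 𝓘_E [] 𝒩`, `B = endListB 2 𝓗 𝓘_E [] 𝒩`
over the family `endFamily 𝓗 𝓘_E [] 𝒩 = [𝓗, 𝓘_E] ++ (charged members)`, simple normal crossings at every point of the cosupport.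
[cite: Kollar2007, (3.111) Step 3, Cor. 3.85] -/
theorem exists_endTwoMonomial_sep (hker : IsEffectiveCartier i.ker) {K 𝓗 : X.IdealSheafData}
    {𝒩 : List (X.IdealSheafData × ℕ)} (h𝓗 : IsEffectiveCartier 𝓗) (h𝒩 : ∀ G ∈ boundaryOf 𝒩, IsEffectiveCartier G)
    (hK : K = 𝓗 ⊔ monomialIdeal 𝒩 * i.ker ^ 2) (hsnc : HasSNC (i.ker :: boundaryOf 𝒩))
    (hpocket : ∀ x : X, x ∈ K.support → x ∉ Set.range i.base →
      SNCWithAt (𝓗 :: i.ker :: boundaryOf (𝒩.filter fun p => decide (0 < p.2))) ⊤ x)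
    (hord : ∀ y : E, y ∈ (K.comap i).support →
      ¬ stalkIdeal (K.comap i) y ≤ maximalIdeal (E.presheaf.stalk y) ^ 2)
    (hnc : ∀ y : E, y ∈ (K.comap i).support → ∀ p ∈ 𝒩, 0 < p.2 → y ∈ (p.1.comap i).support →
      stalkIdeal (p.1.comap i) y ≠ stalkIdeal (K.comap i) y)
    (hjoint : ∀ y : E, y ∈ (K.comap i).support →
      (∃ p ∈ 𝒩, y ∈ (p.1.comap i).support ∧ stalkIdeal (p.1.comap i) y = stalkIdeal (K.comap i) y) ∨
        SNCWithAt (K.comap i :: boundaryOf ((𝒩.map fun p => (p.1.comap i, p.2)).filter fun p => decide (0 < p.2)))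
          ⊤ y) :
    ∃ (M₀ : X.IdealSheafData) (A B : List (X.IdealSheafData × ℕ)),
      IsLocallyPrincipal M₀ ∧ boundaryOf A = boundaryOf B ∧
      (∀ x : X, x ∈ (monomialIdeal A ⊔ monomialIdeal B).support → SNCWithAt (boundaryOf A) ⊤ x) ∧
      K = M₀ * (monomialIdeal A ⊔ monomialIdeal B) := by
  classical
  set ch : List (X.IdealSheafData × ℕ) := 𝒩.filter fun p => decide (0 < p.2) with hch
  have hKE : K.comap i = 𝓗.comap i := comap_host_format i two_ne_zero hK
  have hK' : K = 𝓗 * monomialIdeal ([] : List (X.IdealSheafData × ℕ)) ⊔ monomialIdeal 𝒩 * i.ker ^ 2 := by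
    rw [monomialIdeal_nil, Scheme.IdealSheafData.mul_top]; exact hK
  -- members of the charged list are members
  have hch_mem : ∀ G ∈ boundaryOf ch, G ∈ boundaryOf 𝒩 := fun G hG => by
    obtain ⟨a, -, ha⟩ := mem_boundaryOf_of_mem_filter_pos hG
    exact fst_mem_boundaryOf ha
  have hch_pos : ∀ G ∈ boundaryOf ch, ∃ a, 0 < a ∧ (G, a) ∈ 𝒩 := fun G hG => mem_boundaryOf_of_mem_filter_pos hG
  -- the END family is `𝓗 :: i.ker :: boundaryOf ch`
  have hfam : ∀ G, G ∈ endFamily 𝓗 i.ker [] 𝒩 ↔ G ∈ 𝓗 :: i.ker :: boundaryOf ch := by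
    intro G
    simp only [endFamily, List.filter_nil, boundaryOf, List.map_nil, List.append_nil, List.cons_append, List.nil_append,
      List.mem_cons, hch]
  refine exists_endTwoMonomial_of_halves i hK' ?_ hpocket ?_
  · -- ON `i(E)`
    intro x hxK hxE
    obtain ⟨y, rfl⟩ := hxE
    have hyK : y ∈ (K.comap i).support := by rw [Scheme.IdealSheafData.support_comap]; exact hxK
    have hX : SNCWithAt (i.ker :: boundaryOf 𝒩) ⊤ (i.base y) := hsnc.sncWithAt _
    suffices h : SNCWithAt (𝓗 :: i.ker :: boundaryOf ch) ⊤ (i.base y) from h.anti fun G hG _ => (hfam G).mp hG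
    rcases hjoint y hyK with ⟨p, hp, hyp, hco⟩ | hsncE
    · -- COINCIDENCE with the (uncharged) member `p.1`: swap it out, keep the charged members
      rw [hKE] at hco
      refine sncWithAt_host_cons_of_coincidence_top i y hX h𝓗 (fst_mem_boundaryOf hp)
        (by have h := hyp; rwa [Scheme.IdealSheafData.support_comap] at h) hco (hKE ▸ hord y hyK) fun G hG hxG => ?_
      refine ⟨hch_mem G hG, fun hGp => ?_⟩
      obtain ⟨a, ha, hGa⟩ := hch_pos G hG
      have hyG : y ∈ (G.comap i).support := by rw [Scheme.IdealSheafData.support_comap]; exact hxG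
      refine hnc y hyK (G, a) hGa ha hyG ?_
      rw [hGp, hKE]; exact hco
    · -- SNC case: lift with the host as an extra member (res-D-pv-052)
      have hal : (boundaryOf ch).map (fun G => G.comap i) =
          boundaryOf ((𝒩.map fun p => (p.1.comap i, p.2)).filter fun p => decide (0 < p.2)) :=
        (boundaryOf_filter_map_trace i 𝒩).symm
      have hD' : K.comap i ∉ boundaryOf ((𝒩.map fun p => (p.1.comap i, p.2)).filter fun p => decide (0 < p.2)) := by
        intro hmem
        rw [← hal] at hmem
        obtain ⟨G, hG, hGK⟩ := List.mem_map.mp hmem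
        obtain ⟨a, ha, hGa⟩ := hch_pos G hG
        have hyG : y ∈ (G.comap i).support := by rw [hGK]; exact hyK
        exact hnc y hyK (G, a) hGa ha hyG (by rw [hGK])
      have h := DepthRetract.sncWithAt_host_cons i hker y h𝓗 hKE.symm (fun G hG => h𝒩 G (hch_mem G hG)) hal hD'
        (hX.anti fun G hG _ => by
          rcases List.mem_cons.mp hG with rfl | hG
          · exact List.mem_cons_self
          · exact List.mem_cons_of_mem _ (hch_mem G hG)) hsncE
      exact h.top
  · -- OFF `i(E)`: the END family is the pocket field's family
    intro G hG _ _ _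
    exact (hfam G).mp hG


end DepthSNC

namespace DepthGraded

/-- [OURS · L1 W5.2] **The two-monomial END of F6 stage 2 for res-D-pv-016's `SepFormat`, from the three clauses of
`EndSep (K|_E) 𝒟` written out** (order one of `K|_E` at every point of its cosupport; no coincidence with a CHARGED member of
`𝒟`; coincidence with SOME member of `boundaryOf 𝒟` or snc of `K|_E :: chargedOf 𝒟`) — the by-name `EndTwoMonomialSep SepFormat`
is this lemma after unfolding `EndSep`/`CoincidesAt`/`SepJointAt`/`chargedOf` (TargetsF6 part S, once filed).
[cite: Kollar2007, (3.111) Step 3, Cor. 3.85] -/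
theorem SepFormat.exists_endTwoMonomial {S : Type u} [CommRing S] [IsRegularLocalRing S] {I : Ideal S}
    {E X : Scheme.{u}} {i : E ⟶ X} {g : X ⟶ Spec (.of S)} {K N : X.IdealSheafData} {𝒟 : List (E.IdealSheafData × ℕ)}
    (hinv : DepthTargets.DepthInvariantMono 2 S I E X i g K N) (hQ : SepFormat i K N 𝒟)
    (hord : ∀ y : E, y ∈ (K.comap i).support →
      ¬ stalkIdeal (K.comap i) y ≤ IsLocalRing.maximalIdeal (E.presheaf.stalk y) ^ 2)
    (hnc : ∀ y : E, y ∈ (K.comap i).support → ∀ q ∈ 𝒟, 0 < q.2 → y ∈ q.1.support →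
      stalkIdeal q.1 y ≠ stalkIdeal (K.comap i) y)
    (hjoint : ∀ y : E, y ∈ (K.comap i).support →
      (∃ B ∈ boundaryOf 𝒟, y ∈ B.support ∧ stalkIdeal B y = stalkIdeal (K.comap i) y) ∨
        DepthSNC.SNCWithAt (K.comap i :: (𝒟.filter fun p => 0 < p.2).map Prod.fst) ⊤ y) :
    ∃ (M₀ : X.IdealSheafData) (A B : List (X.IdealSheafData × ℕ)),
      IsLocallyPrincipal M₀ ∧ boundaryOf A = boundaryOf B ∧
      (∀ x : X, x ∈ (monomialIdeal A ⊔ monomialIdeal B).support → DepthSNC.SNCWithAt (boundaryOf A) ⊤ x) ∧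
      K = M₀ * (monomialIdeal A ⊔ monomialIdeal B) := by
  classical
  haveI := hinv.isClosedImmersion
  obtain ⟨𝓗, 𝒩, h𝓗, h𝒩, hal, hK, -, hsnc, -, -, hpocket⟩ := hQ
  subst hal
  refine DepthSNC.exists_endTwoMonomial_sep i hinv.isEffectiveCartier_ker h𝓗 h𝒩 hK hsnc hpocket hord ?_ ?_
  · intro y hy p hp hpos hyp
    exact hnc y hy (p.1.comap i, p.2) (List.mem_map_of_mem hp) hpos hyp
  · intro y hy
    rcases hjoint y hy with ⟨B, hB, hyB, hco⟩ | hs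
    · left
      obtain ⟨a, ha⟩ := mem_boundaryOf_iff.mp hB
      obtain ⟨p, hp, hpB⟩ := List.mem_map.mp ha
      have h1 : p.1.comap i = B := congrArg Prod.fst hpB
      exact ⟨p, hp, h1 ▸ hyB, h1 ▸ hco⟩
    · right
      have h2 : ((𝒩.map fun p => (p.1.comap i, p.2)).filter fun p => 0 < p.2).map Prod.fst =
          boundaryOf ((𝒩.map fun p => (p.1.comap i, p.2)).filter fun p => decide (0 < p.2)) := rfl
      rw [h2] at hs
      exact hs

end DepthGraded

end Summit.ResolutionOfSingularities.ResolutionOfSingularities.Theorems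

end
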